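import Literature.MathematicalPhysics.QuantumLattice.GrassmannGaussianQuadraticInsertion
import Literature.MathematicalPhysics.QuantumLattice.GrassmannIntegralGaussianProofs
import Literature.MathematicalPhysics.QuantumLattice.GrassmannGaussianMeasureChange
import Literature.MathematicalPhysics.QuantumLattice.GrassmannGaussianPfaffian
import HarnessLib

/-!
# Berezin integrals with a quadratic weight are Gaussian expectations: the bridge between the tree's Berezin form
# `∫dψ (·)` (`GrassmannAlgebra.berezin`) and its Laplacian form `∫dμ_C (·)` (`gaussExpect`) of the Grassmann Gaussian integral

Topic `Literature/MathematicalPhysics/QuantumLattice`; generic layer over `GrassmannIntegral.lean` (the Berezin integral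
`berezin R Γ`, top coefficient in the monomial basis; Berezin 1966, Ch. I §3), `GrassmannLaplacian.lean` ∕
`GrassmannEffectiveAction.lean` (the Laplacian-form Gaussian expectation `gaussExpect R C F = constPart (e^{Δ_C} F)`;
Salmhofer 1999, §4.3) and `GrassmannGaussianQuadraticInsertion.lean` (uniqueness of Wick functionals,
`eq_smul_gaussExpect_of_wick`; Feldman–Knörrer–Trubowitz 2002, §I.2–I.3).  The two layers coexist in the tree (the Berezin
form under `GrassmannIntegral*`, `GrassmannGaussianExpectation` (`gaussOn`), `GrassmannGaussianMoments`; the Laplacian form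
under `GrassmannLaplacian*`, the Hubbard files, and the QED₃ files of `QuantumFieldTheory/Dimock2011to13`) without a
stated identification; this file proves it.

statement-level skeleton of published theorems with citation tags; proofs where landed; nothing here is a claim about the Yang–Mills mass gap

**The statement (Feldman–Knörrer–Trubowitz 2002, §I.3; Berezin 1966, Ch. I §3).**  For a quadratic element
`q = Σ_{X,Y} N(X,Y) ψ(X)ψ(Y)` with `S = N − Nᵀ` invertible, `M S = 1`, the functional `F ↦ ∫dψ e^{q} F` obeys Wick's rule
with pair function `−M`; hence, by uniqueness of Wick functionals,

  `∫dψ e^{q} F = (∫dψ e^{q}) · ∫ F dμ_C`   for every `F` and every covariance `C` with pair function `−M`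

(`berezin_grassmannExp_mul`; `C = M` when `Mᵀ = −M`, `berezin_grassmannExp_mul_of_transpose`), and, multiplying through by
`e^{−q}`, the FLAT Berezin integral is a Gaussian one: `∫dψ F = (∫dψ e^{q}) · ∫ e^{−q} F dμ_C`
(`berezin_eq_mul_gaussExpect_grassmannExp_neg_mul`).  The normalisation `∫dψ e^{q}` is the Gaussian Berezin integral of
`GrassmannIntegralGaussianProofs` (`± det` for the two-species form) ∕ `GrassmannGaussianPfaffian` (a Pfaffian in general) and
is not recomputed here; §§4–7 read the identification in the two-species (charged) case, where it becomes
`∫dψ̄dψ e^{ψ̄Aψ} F = (−1)^{n(n−1)∕2} det A · ∫ F dμ_G` with `G = −A⁻¹` and `∫ ψᵢψ̄ⱼ dμ_G = Gᵢⱼ`, evaluate the characteristic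
function `∫ e^{−ψ̄Jψ} dμ_G = det(1 + JG)` and the perturbed covariance `∫ F e^{−ψ̄Jψ} dμ_G = det(1 + JG)·∫ F dμ_{(G⁻¹+J)⁻¹}`
(Dimock–Yuan 2024, App. B Lemmas 23–24, finite form) and the one-species Pfaffian
normalisation, and identify the tree's third Gaussian layer `gaussOn` (`GrassmannGaussianExpectation`) with `gaussExpect`.

**Use-site in print.**  J. Dimock, *Ultraviolet stability for QED in d = 3*, Ann. Henri Poincaré **23** (2022) 2113–2205
(= arXiv:2009.01156v2) [Dimock2022UVStabilityQED3], §4.2.1 LEMMA 20 proof, p.61 L13–51 of the held text layer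
`paper:arxiv-2009.01156`: *"In the `Ψ_K` integral we change to `Ψ_K = Ψ′_{K,L}` with `Ψ′_K` back on `T⁰_{N−K}`. Then
`DΨ_{K,LΩ_K} = L^{|Ω^{(K)}_K|}DΨ′_{K,Ω_K}`. To facilitate estimates we artificially introduce a Gaussian integral by
`DΨ′_{K,Ω_K} = e^{⟨Ψ̄′_K,Ψ′_K⟩_{Ω_K}}dμ_I(Ψ′_K)`. Then we have … (451)"* — the case `q = −⟨Ψ̄′,Ψ′⟩`, `dμ_I` the unit
Gaussian: `∫ F DΨ′ = (∫DΨ′ e^{−⟨Ψ̄′,Ψ′⟩}) · ∫ e^{⟨Ψ̄′,Ψ′⟩}F dμ_I`, i.e. `berezin_eq_mul_gaussExpect_grassmannExp_neg_mul` read on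
the generators `Ω_K ⊕ Ω_K` (this lineage's `Dimock2011to13/QED3LargeFieldFermionIntegration` takes (451)–(452) from here
on; YM LIT SWEEP seat p11, zero weight for the YM-INPRINT tokens).

**What is proved (kernel-checked, zero `sorry`, no definitions, no named facts).**
* §1 **`grassmannDeriv_mem_exteriorPower`** — the left derivative lowers the degree, `∂_X(⋀^{k+1}) ⊆ ⋀^k`
  (`grassmannDeriv_mem_range_pow`); **`berezin_grassmannDeriv`** — *the Berezin integral of a derivative vanishes*,
  `∫dψ ∂_X a = 0` (Berezin 1966, Ch. I §3: lower monomials integrate to zero; checked on the monomial basis by degree).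
* §2 **`sum_mul_berezin_grassmannExp_mul_gen_mul`** — integration by parts against the weight:
  `Σ_W S(Y,W) ∫dψ e^{q}ψ(W)a = −∫dψ e^{q}∂_Y a` (`∂_Y e^{q} = e^{q}∂_Y q`, `∂_Y q = Σ_W S(Y,W)ψ(W)`, from
  `GrassmannGaussianQuadraticInsertion`); **`berezin_grassmannExp_mul_gen_mul`** — the Wick rule
  `∫dψ e^{q}ψ(Z)a = Σ_Y (−M)(Z,Y) ∫dψ e^{q}∂_Y a` when `M S = 1`.
* §3 **`berezin_grassmannExp_mul`**, **`berezin_grassmannExp_mul_of_transpose`**,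
  **`berezin_eq_mul_gaussExpect_grassmannExp_neg_mul`** — the identification, as displayed above.
* §4 (two species, `Γ = ι ⊕ₗ ι`) **`twoSpeciesKernel`** (`ψ̄Aψ = Σ N ψψ`, `quadratic_eq_sum_twoSpeciesKernel`),
  **`twoSpeciesCov R G = [[0, Gᵀ], [−G, 0]]`** (the covariance with `∫ ψᵢψ̄ⱼ dμ_G = Gᵢⱼ`, `∫ ψ̄ᵢψⱼ dμ_G = −Gⱼᵢ`,
  `∫ ψψ = ∫ ψ̄ψ̄ = 0`: `gaussExpect_twoSpeciesCov_psi_mul_psiBar` etc.), `twoSpeciesCov_mul_kernel_sub_transpose`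
  (`C (N − Nᵀ) = 1` iff `A G = −1`), **`berezin_grassmannExp_quadratic_mul(_eq_det_mul)`**
  (`∫dψ̄dψ e^{ψ̄Aψ} F = (−1)^{n(n−1)∕2} det A · ∫ F dμ_G`), **`berezin_eq_det_mul_gaussExpect_twoSpecies`** ∕ **`…_unit`**
  — Dimock's (451) `DΨ = e^{⟨Ψ̄,Ψ⟩}dμ_I(Ψ)` literally, with the tree's orientation constant.
* §5 **`gaussExpect_twoSpeciesCov_grassmannExp_neg_quadratic`** — Dimock–Yuan 2024 App. B LEMMA 23 (473) in finite form,
  `∫ e^{−ψ̄Jψ} dμ_G = det(1 + JG)` for invertible `G` and every `J`; (472) `∫ e^{⟨ψ,Jψ̄⟩} dμ_G = det(1 + JᵀG)`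
  (`…_sum_psi_psiBar`); `∫ e^{ψ̄Jψ} dμ_G = det(1 − JG)` (`…_grassmannExp_quadratic`); and App. B LEMMA 24 part 2
  (479)–(480) in finite form, **`gaussExpect_twoSpeciesCov_grassmannExp_neg_quadratic_mul`**:
  `∫ F e^{−ψ̄Jψ} dμ_G = det(1 + JG) · ∫ F dμ_{G′}` with `G′(1 + JG) = G` (`perturbedCov_mul_one_add_mul`) — a quadratic
  perturbation of the weight is the change of covariance `G ↦ (G⁻¹ + J)⁻¹`; the same identity is Dimock 2025 (D11)
  §2.2 PROPOSITION 3 (57) (the tilted Gaussian `e^{⟨ψ̄,Kψ⟩}dμ_G ∕ ∫e^{⟨ψ̄,Kψ⟩}dμ_G` has covariance `G(1 − KG)⁻¹`):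
  **`gaussExpect_twoSpeciesCov_grassmannExp_quadratic_mul`**, `tiltedCov_mul_one_sub_mul`.
* §6 **`pfaffian_mul_gaussExpect_grassmannExp_sum_sum`** — one species on `Fin n`:
  `Pf(N − Nᵀ) · ∫ e^{ΣJθθ} dμ_M = Pf((N+J) − (N+J)ᵀ)` (`M (N − Nᵀ) = 1`, `Mᵀ = −M`).
* §7 **`gaussOn_map_eq_det_mul_gaussExpect`**, **`gaussOn_map_eq_gaussExpect_smul_gaussOn_one`** — the block integration
  `gaussOn R e A` of `GrassmannGaussianExpectation` on functions of the block equals `((−1)^{n(n−1)∕2} det A · ∫ · dμ_G)·1`;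
  **`gaussOn_grassmannExp_sources_eq_det_smul`** — Dimock 2025 (D11) §2.3 PROPOSITION 5 (67), the generating function
  `∫ e^{⟨J̄,ψ⟩+⟨ψ̄,J⟩} dμ_G = e^{⟨J̄,GJ⟩}` with Grassmann sources, finite form (the tree's `gaussOn_grassmannExp_sources` read
  with `G = −A⁻¹`).

**Readings ∕ scope.**  `R` is any commutative `ℚ`-algebra, `Γ` any finite linearly ordered label type (the order fixes the
orientation of `berezin`); `N` is arbitrary, only `S = N − Nᵀ` and a left inverse `M` of `S` enter.  In the two-species
specialisation (`Γ = ι ⊕ₗ ι`, `q = Σ A_{ij}ψ̄_iψ_j` = `GrassmannAlgebra.quadratic A`) `M` is the block matrix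
`[[0, −A⁻ᵀ], [A⁻¹, 0]] = twoSpeciesCov R (−A⁻¹)`, stated with a matrix `G` and the hypothesis `A G = −1` (no inverses
computed); §5 is the finite-dimensional case only (finite index set, `G` invertible) of a lemma printed for trace-class
covariances on a torus with a Fredholm determinant; nothing about convergence, infinite lattices or `d = 4`.

J. Dimock, C. Yuan, *Structural stability of the RG flow in the Gross–Neveu model*, arXiv:2303.07916 [DimockYuan2024GNFlow],
App. B p.70–71 of the held text layer `paper:arxiv-2303.07916`.
-/

noncomputable section

namespace Literature.MathematicalPhysics.QuantumLattice

open GrassmannAlgebra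

/-! ## §1 The Berezin integral of a derivative vanishes -/

section Derivative

variable (R : Type*) [CommRing R] {Γ : Type*}

/-- **The left derivative lowers the degree** (range form): `∂_X` maps `(range ι)^{k+1}` into `(range ι)^k` — on a product
`ι(v)·n` it acts by `∂_X(ι(v)·n) = v(X)n − ι(v)·∂_X n` (`grassmannDeriv_ι_mul`), and `∂_X ι(v) = v(X)` is a scalar.
[cite: Berezin1966, Ch. I §3] -/
theorem grassmannDeriv_mem_range_pow (X : Γ) :
    ∀ (k : ℕ) {a : GrassmannAlgebra R Γ}, a ∈ LinearMap.range (ExteriorAlgebra.ι R) ^ (k + 1) →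
      grassmannDeriv R X a ∈ LinearMap.range (ExteriorAlgebra.ι R (M := Γ → R)) ^ k := by
  intro k
  induction k with
  | zero =>
    intro a ha
    rw [zero_add, pow_one] at ha
    obtain ⟨v, rfl⟩ := LinearMap.mem_range.mp ha
    rw [grassmannDeriv_ι, pow_zero]
    exact Submodule.mem_one.mpr ⟨v X, rfl⟩
  | succ k ih =>
    intro a ha
    rw [pow_succ'] at ha
    refine Submodule.mul_induction_on ha (fun m hm n hn => ?_)
      (fun x y hx hy => by rw [map_add]; exact add_mem hx hy)
    obtain ⟨v, rfl⟩ := LinearMap.mem_range.mp hm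
    rw [grassmannDeriv_ι_mul]
    refine sub_mem (Submodule.smul_mem _ _ hn) ?_
    rw [pow_succ']
    exact Submodule.mul_mem_mul (LinearMap.mem_range_self _ v) (ih hn)

/-- **The left derivative lowers the degree**: `∂_X(⋀^{k+1}) ⊆ ⋀^k`. [cite: Berezin1966, Ch. I §3] -/
theorem grassmannDeriv_mem_exteriorPower (X : Γ) (k : ℕ) {a : GrassmannAlgebra R Γ}
    (ha : a ∈ ⋀[R]^(k + 1) (Γ → R)) : grassmannDeriv R X a ∈ ⋀[R]^k (Γ → R) := by
  rw [ExteriorAlgebra.exteriorPower] at ha ⊢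
  exact grassmannDeriv_mem_range_pow R X k ha

variable [LinearOrder Γ] [Fintype Γ]

/-- **The Berezin integral of a derivative vanishes**: `∫dψ ∂_X a = 0` for every `a` — a derivative has no top-degree
component (on the monomial basis: `θ_∅ = 1` is killed by `∂_X`, and `θ_s`, `|s| = k + 1`, is sent into `⋀^k` with
`k < |Γ|`, where `berezin` vanishes, `berezin_eq_zero_of_mem_exteriorPower`).  This is the integration-by-parts identity
behind every Gaussian Berezin computation. [cite: Berezin1966, Ch. I §3 (3.4)] -/
theorem berezin_grassmannDeriv (X : Γ) (a : GrassmannAlgebra R Γ) :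
    berezin R Γ (grassmannDeriv R X a) = 0 := by
  suffices h : berezin R Γ ∘ₗ grassmannDeriv R X = 0 from LinearMap.congr_fun h a
  refine (grassmannBasis R Γ).ext fun s => ?_
  rw [LinearMap.comp_apply, LinearMap.zero_apply]
  have hs := grassmannBasis_mem_exteriorPower R s
  rcases Nat.eq_zero_or_pos s.card with h0 | hpos
  · rw [Finset.card_eq_zero.mp h0]
    have h1 : grassmannBasis R Γ ∅ = 1 := by
      rw [grassmannBasis_eq_prod_map_gen]; simp
    rw [h1, grassmannDeriv_one, map_zero]
  · obtain ⟨k, hk⟩ := Nat.exists_eq_add_of_le' hpos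
    rw [hk] at hs
    refine berezin_eq_zero_of_mem_exteriorPower R (k := k) ?_ (grassmannDeriv_mem_exteriorPower R X k hs)
    have hle : s.card ≤ Fintype.card Γ := Finset.card_le_univ s
    omega

/-- The composite `berezin ∘ ∂_X` is the zero functional. [cite: Berezin1966, Ch. I §3 (3.4)] -/
theorem berezin_comp_grassmannDeriv (X : Γ) : berezin R Γ ∘ₗ grassmannDeriv R X = 0 :=
  LinearMap.ext fun a => berezin_grassmannDeriv R X a

end Derivative

/-! ## §2 The Wick rule for the functional `F ↦ ∫dψ e^{q} F` -/

section Wick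

variable {R : Type*} [CommRing R] [Algebra ℚ R] {Γ : Type*} [LinearOrder Γ] [Fintype Γ]
variable (N : Matrix Γ Γ R) {q : GrassmannAlgebra R Γ} (hq : q = ∑ X, ∑ Y, N X Y • (gen R X * gen R Y))
include hq

/-- **Integration by parts against the quadratic weight**: with `S = N − Nᵀ`,
`Σ_W S(Y,W) ∫dψ e^{q} ψ(W) a = −∫dψ e^{q} ∂_Y a` — apply `∫dψ ∂_Y(·) = 0` to `e^{q}a` and use `∂_Y(e^{q}a) =
e^{q}(∂_Y q)a + e^{q}∂_Y a` (`e^{q}` is even), `∂_Y q = Σ_W S(Y,W)ψ(W)`.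
[cite: FeldmanKnorrerTrubowitz2002, §I.3] -/
theorem sum_mul_berezin_grassmannExp_mul_gen_mul (Y : Γ) (a : GrassmannAlgebra R Γ) :
    ∑ W, (N Y W - N W Y) * berezin R Γ (grassmannExp q * (gen R W * a)) =
      -berezin R Γ (grassmannExp q * grassmannDeriv R Y a) := by
  have hE := grassmannExp_mem_evenOdd_zero R (quadratic_mem_evenOdd_zero_of_eq N hq)
    (isNilpotent_of_eq_quadratic N hq)
  have h0 := berezin_grassmannDeriv R Y (grassmannExp q * a)
  rw [grassmannDeriv_mul_of_involute_eq R Y (CliffordAlgebra.involute_eq_of_mem_even hE),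
    grassmannDeriv_grassmannExp_of_eq_quadratic N hq, map_add, mul_assoc, Finset.sum_mul, Finset.mul_sum,
    map_sum] at h0
  simp only [smul_mul_assoc, mul_smul_comm, map_smul, smul_eq_mul] at h0
  exact eq_neg_of_add_eq_zero_left h0

variable {S M : Matrix Γ Γ R} (hS : S = Matrix.of fun X Y => N X Y - N Y X) (hM : M * S = 1)
include hS hM

/-- **The Wick rule for the Berezin functional with weight `e^{q}`**: if `M S = 1` (`S = N − Nᵀ`), then
`∫dψ e^{q} ψ(Z) a = Σ_Y (−M)(Z,Y) · ∫dψ e^{q} ∂_Y a` — the pair function of `F ↦ ∫dψ e^{q}F` is `−S⁻¹`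
(solve the linear system of `sum_mul_berezin_grassmannExp_mul_gen_mul` with `M`). [cite: FeldmanKnorrerTrubowitz2002, §I.3] -/
theorem berezin_grassmannExp_mul_gen_mul (Z : Γ) (a : GrassmannAlgebra R Γ) :
    berezin R Γ (grassmannExp q * (gen R Z * a)) =
      ∑ Y, (-M Z Y) * berezin R Γ (grassmannExp q * grassmannDeriv R Y a) := by
  set φ : Γ → R := fun W => berezin R Γ (grassmannExp q * (gen R W * a)) with hφ
  set d : Γ → R := fun Y => berezin R Γ (grassmannExp q * grassmannDeriv R Y a) with hd
  have hvec : S.mulVec φ = -d := by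
    funext Y
    simp only [Matrix.mulVec, dotProduct, hS, Matrix.of_apply, Pi.neg_apply, hφ, hd]
    exact sum_mul_berezin_grassmannExp_mul_gen_mul N hq Y a
  have hsolve : φ = M.mulVec (-d) := by
    rw [← hvec, Matrix.mulVec_mulVec, hM, Matrix.one_mulVec]
  have := congrFun hsolve Z
  simpa only [hφ, hd, Matrix.mulVec, dotProduct, Pi.neg_apply, mul_neg, neg_mul] using this

/-! ## §3 The identification `∫dψ e^{q} F = (∫dψ e^{q}) · ∫ F dμ_C` -/

/-- **Berezin integrals with a quadratic weight are Gaussian expectations**: with `q = Σ N(X,Y)ψ(X)ψ(Y)`, `S = N − Nᵀ`,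
`M S = 1`, and `C` ANY covariance whose pair function `½(C(Y,X) − C(X,Y))` is `−M(X,Y)`:
`∫dψ e^{q} F = (∫dψ e^{q}) · ∫ F dμ_C` for every `F` — by uniqueness of Wick functionals
(`eq_smul_gaussExpect_of_wick`) applied to `F ↦ ∫dψ e^{q}F`.  (Feldman–Knörrer–Trubowitz 2002, §I.3: the Grassmann
Gaussian integral `∫ e^{Σψ̄Aψ} F dψ̄dψ ∕ ∫ e^{Σψ̄Aψ} dψ̄dψ` IS the Gaussian measure of covariance `A⁻¹`; Berezin 1966, Ch. I §3.)
[cite: FeldmanKnorrerTrubowitz2002, §I.3] -/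
theorem berezin_grassmannExp_mul {C : Matrix Γ Γ R}
    (hC : ∀ X Y, ((1 / 2 : ℚ) • (1 : R)) * (C Y X - C X Y) = -M X Y) (F : GrassmannAlgebra R Γ) :
    berezin R Γ (grassmannExp q * F) = berezin R Γ (grassmannExp q) * gaussExpect R C F := by
  set Φ : GrassmannAlgebra R Γ →ₗ[R] R := berezin R Γ ∘ₗ LinearMap.mulLeft R (grassmannExp q) with hΦdef
  have hΦ : ∀ (X : Γ) (a : GrassmannAlgebra R Γ),
      Φ (gen R X * a) = ∑ Y, (((1 / 2 : ℚ) • (1 : R)) * (C Y X - C X Y)) * Φ (grassmannDeriv R Y a) := by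
    intro X a
    simp only [hΦdef, LinearMap.coe_comp, Function.comp_apply, LinearMap.mulLeft_apply, hC]
    exact berezin_grassmannExp_mul_gen_mul N hq hS hM X a
  have h := eq_smul_gaussExpect_of_wick R Φ C hΦ
  have hF := LinearMap.congr_fun h F
  simp only [hΦdef, LinearMap.coe_comp, Function.comp_apply, LinearMap.mulLeft_apply, LinearMap.smul_apply,
    smul_eq_mul, mul_one] at hF
  exact hF

/-- **Canonical covariance**: when the left inverse `M` of `S = N − Nᵀ` is antisymmetric (as the two-sided inverse of the
antisymmetric `S` is), `C = M` itself has pair function `−M`, so `∫dψ e^{q} F = (∫dψ e^{q}) · ∫ F dμ_M`.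
[cite: FeldmanKnorrerTrubowitz2002, §I.3] -/
theorem berezin_grassmannExp_mul_of_transpose (hMt : M.transpose = -M) (F : GrassmannAlgebra R Γ) :
    berezin R Γ (grassmannExp q * F) = berezin R Γ (grassmannExp q) * gaussExpect R M F := by
  refine berezin_grassmannExp_mul N hq hS hM (fun X Y => ?_) F
  have hYX : M Y X = -M X Y := by rw [← Matrix.transpose_apply M X Y, hMt, Matrix.neg_apply]
  rw [hYX, show -M X Y - M X Y = -M X Y + -M X Y by ring, half_smul_one_mul_add_self]

/-- **The flat Berezin integral as a Gaussian one** — the shape of Dimock's (451) *"we artificially introduce a Gaussian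
integral by `DΨ′ = e^{⟨Ψ̄′,Ψ′⟩}dμ_I(Ψ′)`"*: for every `F`, `∫dψ F = (∫dψ e^{q}) · ∫ e^{−q}F dμ_C` (`C` with pair function
`−M`; `e^{q}e^{−q} = 1` for the nilpotent even `q`). [cite: Dimock2022UVStabilityQED3, §4.2.1 Lemma 20 proof (451) p.61
L13–51; FeldmanKnorrerTrubowitz2002, §I.3] -/
theorem berezin_eq_mul_gaussExpect_grassmannExp_neg_mul {C : Matrix Γ Γ R}
    (hC : ∀ X Y, ((1 / 2 : ℚ) • (1 : R)) * (C Y X - C X Y) = -M X Y) (F : GrassmannAlgebra R Γ) :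
    berezin R Γ F = berezin R Γ (grassmannExp q) * gaussExpect R C (grassmannExp (-q) * F) := by
  have hnil := isNilpotent_of_eq_quadratic N hq
  have h1 : grassmannExp q * grassmannExp (-q) = 1 := by
    rw [grassmannExp, grassmannExp, ← IsNilpotent.exp_add_of_commute (Commute.neg_right (Commute.refl q)) hnil hnil.neg,
      add_neg_cancel, IsNilpotent.exp_zero]
  have h := berezin_grassmannExp_mul N hq hS hM hC (grassmannExp (-q) * F)
  rwa [← mul_assoc, h1, one_mul] at h

end Wick


/-! ## §4 The two-species instance: `∫dψ̄dψ e^{ψ̄Aψ} F = (ε det A) · ∫ F dμ_G`, `G = −A⁻¹` -/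

section TwoSpecies

variable (R : Type*) [CommRing R] {ι : Type*}

/-- The kernel of the two-species quadratic action `ψ̄Aψ = Σᵢⱼ Aᵢⱼ ψ̄ᵢψⱼ` (`GrassmannAlgebra.quadratic`) written as a one-species
form `Σ_{X,Y} N(X,Y) ψ(X)ψ(Y)` on the generators `ι ⊕ₗ ι` (`ψ̄ = inl`, `ψ = inr`): the block matrix `N = [[0, A], [0, 0]]`
(`quadratic_eq_sum_twoSpeciesKernel`). [cite: FeldmanKnorrerTrubowitz2002, §I.3] -/
def twoSpeciesKernel (A : Matrix ι ι R) : Matrix (ι ⊕ₗ ι) (ι ⊕ₗ ι) R :=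
  (Matrix.fromBlocks 0 A 0 0).submatrix ofLex ofLex

/-- **The two-species covariance with pair matrix `G`** — the covariance `C` on `ι ⊕ₗ ι` of the Laplacian-form Gaussian
expectation `gaussExpect R C` realising the charged Gaussian Grassmann integral `dμ_G` of the fermion literature:
`∫ ψᵢψ̄ⱼ dμ_G = Gᵢⱼ`, `∫ ψ̄ᵢψⱼ dμ_G = −Gⱼᵢ`, `∫ ψψ dμ_G = ∫ ψ̄ψ̄ dμ_G = 0` (`gaussExpect_twoSpeciesCov_psi_mul_psiBar` etc.):
the antisymmetric block matrix `C = [[0, Gᵀ], [−G, 0]]` (Dimock–Yuan 2024, App. B: "Gaussian with covariance `G`",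
`∫ ψ(x)ψ̄(y) dμ_G = G(x,y)` as read off (475); Feldman–Knörrer–Trubowitz 2002, §I.3). [cite: DimockYuan2024GNFlow, App. B
Lemma 23 (472)–(475) p.70–71] -/
def twoSpeciesCov (G : Matrix ι ι R) : Matrix (ι ⊕ₗ ι) (ι ⊕ₗ ι) R :=
  (Matrix.fromBlocks 0 G.transpose (-G) 0).submatrix ofLex ofLex

variable (A G : Matrix ι ι R)

/-- The `ψ̄ψ` block of the kernel is `A`: `N(ψ̄ᵢ, ψⱼ) = Aᵢⱼ`. [cite: FeldmanKnorrerTrubowitz2002, §I.3] -/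
@[simp] theorem twoSpeciesKernel_inl_inr (i j : ι) :
    twoSpeciesKernel R A (toLex (Sum.inl i)) (toLex (Sum.inr j)) = A i j := rfl

/-- The `ψ̄ψ̄` block of the kernel vanishes. [cite: FeldmanKnorrerTrubowitz2002, §I.3] -/
@[simp] theorem twoSpeciesKernel_inl_inl (i j : ι) :
    twoSpeciesKernel R A (toLex (Sum.inl i)) (toLex (Sum.inl j)) = 0 := rfl

/-- The `ψψ̄` block of the kernel vanishes. [cite: FeldmanKnorrerTrubowitz2002, §I.3] -/
@[simp] theorem twoSpeciesKernel_inr_inl (i j : ι) :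
    twoSpeciesKernel R A (toLex (Sum.inr i)) (toLex (Sum.inl j)) = 0 := rfl

/-- The `ψψ` block of the kernel vanishes. [cite: FeldmanKnorrerTrubowitz2002, §I.3] -/
@[simp] theorem twoSpeciesKernel_inr_inr (i j : ι) :
    twoSpeciesKernel R A (toLex (Sum.inr i)) (toLex (Sum.inr j)) = 0 := rfl

/-- The `ψ̄ψ` block of the covariance is `Gᵀ`: `C(ψ̄ᵢ, ψⱼ) = Gⱼᵢ`. [cite: DimockYuan2024GNFlow, App. B Lemma 23 (472)–(475) p.70–71] -/
@[simp] theorem twoSpeciesCov_inl_inr (i j : ι) :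
    twoSpeciesCov R G (toLex (Sum.inl i)) (toLex (Sum.inr j)) = G j i := rfl

/-- The `ψψ̄` block of the covariance is `−G`: `C(ψᵢ, ψ̄ⱼ) = −Gᵢⱼ`. [cite: DimockYuan2024GNFlow, App. B Lemma 23 (472)–(475) p.70–71] -/
@[simp] theorem twoSpeciesCov_inr_inl (i j : ι) :
    twoSpeciesCov R G (toLex (Sum.inr i)) (toLex (Sum.inl j)) = -G i j := rfl

/-- The `ψ̄ψ̄` block of the covariance vanishes. [cite: DimockYuan2024GNFlow, App. B Lemma 23 (472)–(475) p.70–71] -/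
@[simp] theorem twoSpeciesCov_inl_inl (i j : ι) :
    twoSpeciesCov R G (toLex (Sum.inl i)) (toLex (Sum.inl j)) = 0 := rfl

/-- The `ψψ` block of the covariance vanishes. [cite: DimockYuan2024GNFlow, App. B Lemma 23 (472)–(475) p.70–71] -/
@[simp] theorem twoSpeciesCov_inr_inr (i j : ι) :
    twoSpeciesCov R G (toLex (Sum.inr i)) (toLex (Sum.inr j)) = 0 := rfl

/-- `C = [[0, Gᵀ], [−G, 0]]` is antisymmetric. [cite: DimockYuan2024GNFlow, App. B Lemma 23 (472)–(475) p.70–71] -/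
theorem twoSpeciesCov_transpose : (twoSpeciesCov R G).transpose = -twoSpeciesCov R G := by
  ext X Y
  obtain ⟨x, rfl⟩ := toLex.surjective X
  obtain ⟨y, rfl⟩ := toLex.surjective Y
  rcases x with i | i <;> rcases y with j | j <;>
    simp [twoSpeciesCov, Matrix.submatrix_apply]

/-- The two-species covariance is additive in `G`. [cite: DimockYuan2024GNFlow, App. B Lemma 23 (472)–(475) p.70–71] -/
theorem twoSpeciesCov_add (G₁ G₂ : Matrix ι ι R) :
    twoSpeciesCov R (G₁ + G₂) = twoSpeciesCov R G₁ + twoSpeciesCov R G₂ := by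
  ext X Y
  obtain ⟨x, rfl⟩ := toLex.surjective X
  obtain ⟨y, rfl⟩ := toLex.surjective Y
  rcases x with i | i <;> rcases y with j | j <;>
    simp [twoSpeciesCov, Matrix.submatrix_apply, add_comm]

/-- `twoSpeciesCov R 0 = 0`. [cite: DimockYuan2024GNFlow, App. B Lemma 23 (472)–(475) p.70–71] -/
@[simp] theorem twoSpeciesCov_zero : twoSpeciesCov R (0 : Matrix ι ι R) = 0 := by
  ext X Y
  obtain ⟨x, rfl⟩ := toLex.surjective X
  obtain ⟨y, rfl⟩ := toLex.surjective Y
  rcases x with i | i <;> rcases y with j | j <;>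
    simp [twoSpeciesCov, Matrix.submatrix_apply]

/-- The two-species covariance is `R`-linear in `G`. [cite: DimockYuan2024GNFlow, App. B Lemma 23 (472)–(475) p.70–71] -/
theorem twoSpeciesCov_smul (c : R) (G : Matrix ι ι R) : twoSpeciesCov R (c • G) = c • twoSpeciesCov R G := by
  ext X Y
  obtain ⟨x, rfl⟩ := toLex.surjective X
  obtain ⟨y, rfl⟩ := toLex.surjective Y
  rcases x with i | i <;> rcases y with j | j <;>
    simp [twoSpeciesCov, Matrix.submatrix_apply]

/-- The antisymmetrisation `S = N − Nᵀ` of the kernel `N = [[0, A], [0, 0]]` is the block matrix `[[0, A], [−Aᵀ, 0]]`.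
[cite: FeldmanKnorrerTrubowitz2002, §I.3] -/
theorem twoSpeciesKernel_sub_transpose :
    (Matrix.of fun X Y => twoSpeciesKernel R A X Y - twoSpeciesKernel R A Y X) =
      (Matrix.fromBlocks 0 A (-A.transpose) 0).submatrix ofLex ofLex := by
  ext X Y
  obtain ⟨x, rfl⟩ := toLex.surjective X
  obtain ⟨y, rfl⟩ := toLex.surjective Y
  rcases x with i | i <;> rcases y with j | j <;>
    simp [twoSpeciesKernel, Matrix.submatrix_apply]

variable [LinearOrder ι] [Fintype ι]

/-- **`ψ̄Aψ` in one-species form**: `quadratic R A = Σ_{X,Y} N(X,Y) ψ(X)ψ(Y)` with `N = twoSpeciesKernel R A`.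
[cite: FeldmanKnorrerTrubowitz2002, §I.3] -/
theorem quadratic_eq_sum_twoSpeciesKernel :
    quadratic R A = ∑ X, ∑ Y, twoSpeciesKernel R A X Y • (gen R X * gen R Y) := by
  rw [← Equiv.sum_comp (toLex : ι ⊕ ι ≃ ι ⊕ₗ ι), Fintype.sum_sum_type]
  simp_rw [← Equiv.sum_comp (toLex : ι ⊕ ι ≃ ι ⊕ₗ ι) (fun Y => twoSpeciesKernel R A _ Y • (gen R _ * gen R Y)),
    Fintype.sum_sum_type]
  simp only [twoSpeciesKernel_inl_inl, twoSpeciesKernel_inl_inr, twoSpeciesKernel_inr_inl, twoSpeciesKernel_inr_inr,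
    zero_smul, Finset.sum_const_zero, zero_add, add_zero]
  rfl

variable {A G}
variable (hAG : A * G = -1)
include hAG

/-- From `A G = −1`: `G A = −1` (square matrices over a commutative ring). [folklore] -/
private theorem mul_eq_neg_one_comm_of_mul_eq_neg_one : G * A = -1 := by
  have h : A * (-G) = 1 := by rw [Matrix.mul_neg, hAG, neg_neg]
  have h' : (-G) * A = 1 := mul_eq_one_comm.mp h
  rwa [Matrix.neg_mul, neg_eq_iff_eq_neg] at h'

/-- **`C = twoSpeciesCov R G` inverts the antisymmetrised kernel**: `C · (N − Nᵀ) = 1` when `A G = −1`, i.e. `G = −A⁻¹`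
— blockwise, `[[0, Gᵀ], [−G, 0]] · [[0, A], [−Aᵀ, 0]] = [[−GᵀAᵀ, 0], [0, −GA]] = 1`. [cite: FeldmanKnorrerTrubowitz2002, §I.3] -/
theorem twoSpeciesCov_mul_kernel_sub_transpose :
    twoSpeciesCov R G * (Matrix.of fun X Y => twoSpeciesKernel R A X Y - twoSpeciesKernel R A Y X) = 1 := by
  have hGA : G * A = -1 := mul_eq_neg_one_comm_of_mul_eq_neg_one R hAG
  rw [twoSpeciesKernel_sub_transpose, twoSpeciesCov, Matrix.submatrix_mul_equiv, Matrix.fromBlocks_multiply]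
  have h11 : G.transpose * -A.transpose = 1 := by
    rw [Matrix.mul_neg, ← Matrix.transpose_mul, hAG, Matrix.transpose_neg, Matrix.transpose_one, neg_neg]
  have h22 : -G * A = 1 := by rw [Matrix.neg_mul, hGA, neg_neg]
  simp only [Matrix.zero_mul, Matrix.mul_zero, zero_add, add_zero, h11, h22, Matrix.fromBlocks_one]
  exact Matrix.submatrix_one_equiv _

variable [Algebra ℚ R]

/-- **Berezin integrals with the weight `e^{ψ̄Aψ}` are charged Gaussian expectations with covariance `G = −A⁻¹`**:
for `A G = −1` and every `F`,

  `∫dψ̄dψ e^{ψ̄Aψ} F = (∫dψ̄dψ e^{ψ̄Aψ}) · ∫ F dμ_G`,   `dμ_G = gaussExpect R (twoSpeciesCov R G)`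

(§3 read on `Γ = ι ⊕ₗ ι` with `N = twoSpeciesKernel R A`, `M = C = twoSpeciesCov R G`).  Feldman–Knörrer–Trubowitz 2002,
§I.3: the Grassmann Gaussian integral `∫ e^{Σψ̄Aψ} F dψ̄dψ ∕ ∫ e^{Σψ̄Aψ} dψ̄dψ` is a Gaussian measure determined by `A⁻¹`;
in this file's dictionary `∫ ψᵢψ̄ⱼ dμ_G = Gᵢⱼ = −(A⁻¹)ᵢⱼ`, `∫ ψ̄ᵢψⱼ dμ_G = (A⁻¹)ⱼᵢ`. [cite: FeldmanKnorrerTrubowitz2002, §I.3] -/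
theorem berezin_grassmannExp_quadratic_mul (F : GrassmannAlgebra R (ι ⊕ₗ ι)) :
    berezin R (ι ⊕ₗ ι) (grassmannExp (quadratic R A) * F) =
      berezin R (ι ⊕ₗ ι) (grassmannExp (quadratic R A)) * gaussExpect R (twoSpeciesCov R G) F :=
  berezin_grassmannExp_mul_of_transpose (twoSpeciesKernel R A) (quadratic_eq_sum_twoSpeciesKernel R A) rfl
    (twoSpeciesCov_mul_kernel_sub_transpose R hAG) (twoSpeciesCov_transpose R G) F

/-- **… with the normalisation evaluated**: `∫dψ̄dψ e^{ψ̄Aψ} F = (−1)^{n(n−1)∕2} det A · ∫ F dμ_G` (`A G = −1`,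
`n = |ι|`; `berezin_grassmannExp_quadratic`, Berezin 1966 Ch. I §3 Thm 3.1). [cite: Berezin1966, Ch. I §3 Thm. 3.1] -/
theorem berezin_grassmannExp_quadratic_mul_eq_det_mul (F : GrassmannAlgebra R (ι ⊕ₗ ι)) :
    berezin R (ι ⊕ₗ ι) (grassmannExp (quadratic R A) * F) =
      (-1 : R) ^ (Fintype.card ι * (Fintype.card ι - 1) / 2) * A.det * gaussExpect R (twoSpeciesCov R G) F := by
  rw [berezin_grassmannExp_quadratic_mul R hAG, berezin_grassmannExp_quadratic_holds R A]

/-- **Dimock's (451), literally**: the flat two-species Berezin integral is a Gaussian one after inserting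
`1 = e^{ψ̄Aψ}e^{−ψ̄Aψ}` — for `A G = −1` and every `F`,

  `∫dψ̄dψ F = (−1)^{n(n−1)∕2} det A · ∫ e^{−ψ̄Aψ} F dμ_G`.

With `A = −1`, `G = 1` this is *"`DΨ′_{K,Ω_K} = e^{⟨Ψ̄′_K,Ψ′_K⟩_{Ω_K}} dμ_I(Ψ′_K)`"* (D8 = Dimock, *Ultraviolet stability for QED in
d = 3*, §4.2.1 LEMMA 20 proof, (451), p.61 L13–51 of `paper:arxiv-2009.01156`), the unit-covariance Gaussian `dμ_I`,
`∫ ψᵢψ̄ⱼ dμ_I = δᵢⱼ`, up to the orientation constant `(−1)^{n(n−1)∕2} det(−1) = (−1)^{n(n+1)∕2}` of the tree's `berezin`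
(`berezin_eq_det_mul_gaussExpect_unit`). [cite: Dimock2022UVStabilityQED3, §4.2.1 Lemma 20 proof (451) p.61 L13–51] -/
theorem berezin_eq_det_mul_gaussExpect_twoSpecies (F : GrassmannAlgebra R (ι ⊕ₗ ι)) :
    berezin R (ι ⊕ₗ ι) F = (-1 : R) ^ (Fintype.card ι * (Fintype.card ι - 1) / 2) * A.det *
      gaussExpect R (twoSpeciesCov R G) (grassmannExp (-quadratic R A) * F) := by
  have h1 : grassmannExp (quadratic R A) * grassmannExp (-quadratic R A) = 1 := by
    rw [← quadratic_neg, ← grassmannExp_quadratic_add, add_neg_cancel, quadratic_zero, grassmannExp,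
      IsNilpotent.exp_zero]
  have h := berezin_grassmannExp_quadratic_mul_eq_det_mul R hAG (grassmannExp (-quadratic R A) * F)
  rwa [← mul_assoc, h1, one_mul] at h

omit hAG in
/-- **(451) with Dimock's unit covariance**: `∫dψ̄dψ F = (−1)^{n(n−1)∕2}(−1)^n · ∫ e^{ψ̄ψ} F dμ_I`, `dμ_I` the two-species
Gaussian with `∫ ψᵢψ̄ⱼ dμ_I = δᵢⱼ` (`twoSpeciesCov R 1`). [cite: Dimock2022UVStabilityQED3, §4.2.1 Lemma 20 proof (451)
p.61 L13–51] -/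
theorem berezin_eq_det_mul_gaussExpect_unit (F : GrassmannAlgebra R (ι ⊕ₗ ι)) :
    berezin R (ι ⊕ₗ ι) F = (-1 : R) ^ (Fintype.card ι * (Fintype.card ι - 1) / 2) * (-1) ^ Fintype.card ι *
      gaussExpect R (twoSpeciesCov R 1) (grassmannExp (quadratic R 1) * F) := by
  have hAG : (-1 : Matrix ι ι R) * 1 = -1 := by rw [Matrix.mul_one]
  rw [berezin_eq_det_mul_gaussExpect_twoSpecies R hAG F, quadratic_neg, neg_neg, Matrix.det_neg, Matrix.det_one,
    mul_one]

omit hAG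

/-! ### The two-point dictionary of `dμ_G` -/

/-- `∫ ψᵢψ̄ⱼ dμ_G = Gᵢⱼ` (Dimock–Yuan 2024, App. B, as read off (475)). [cite: DimockYuan2024GNFlow, App. B (475) p.71] -/
theorem gaussExpect_twoSpeciesCov_psi_mul_psiBar (i j : ι) :
    gaussExpect R (twoSpeciesCov R G) (psi R i * psiBar R j) = G i j := by
  rw [psi, psiBar, gaussExpect_gen_mul_gen, twoSpeciesCov_inl_inr, twoSpeciesCov_inr_inl, sub_neg_eq_add,
    half_smul_one_mul_add_self]

/-- `∫ ψ̄ᵢψⱼ dμ_G = −Gⱼᵢ`. [cite: DimockYuan2024GNFlow, App. B (475) p.71] -/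
theorem gaussExpect_twoSpeciesCov_psiBar_mul_psi (i j : ι) :
    gaussExpect R (twoSpeciesCov R G) (psiBar R i * psi R j) = -(G j i) := by
  rw [psi, psiBar, gaussExpect_gen_mul_gen, twoSpeciesCov_inl_inr, twoSpeciesCov_inr_inl, ← neg_add', mul_neg,
    half_smul_one_mul_add_self]

/-- `∫ ψᵢψⱼ dμ_G = 0` (charge conservation). [cite: DimockYuan2024GNFlow, App. B Lemma 23 (472)–(475) p.70–71] -/
theorem gaussExpect_twoSpeciesCov_psi_mul_psi (i j : ι) :
    gaussExpect R (twoSpeciesCov R G) (psi R i * psi R j) = 0 := by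
  rw [psi, psi, gaussExpect_gen_mul_gen, twoSpeciesCov_inr_inr, twoSpeciesCov_inr_inr, sub_zero, mul_zero]

/-- `∫ ψ̄ᵢψ̄ⱼ dμ_G = 0` (charge conservation). [cite: DimockYuan2024GNFlow, App. B Lemma 23 (472)–(475) p.70–71] -/
theorem gaussExpect_twoSpeciesCov_psiBar_mul_psiBar (i j : ι) :
    gaussExpect R (twoSpeciesCov R G) (psiBar R i * psiBar R j) = 0 := by
  rw [psiBar, psiBar, gaussExpect_gen_mul_gen, twoSpeciesCov_inl_inl, twoSpeciesCov_inl_inl, sub_zero, mul_zero]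

/-- **The Berezin-form moments re-derived**: with `A G = −1`, the normalised Berezin expectation of `ψᵢψ̄ⱼ` is `Gᵢⱼ`:
`∫dψ̄dψ e^{ψ̄Aψ} ψᵢψ̄ⱼ = (−1)^{n(n−1)∕2} det A · Gᵢⱼ`. [cite: FeldmanKnorrerTrubowitz2002, §I.3] -/
theorem berezin_grassmannExp_quadratic_mul_psi_mul_psiBar (hAG : A * G = -1) (i j : ι) :
    berezin R (ι ⊕ₗ ι) (grassmannExp (quadratic R A) * (psi R i * psiBar R j)) =
      (-1 : R) ^ (Fintype.card ι * (Fintype.card ι - 1) / 2) * A.det * G i j := by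
  rw [berezin_grassmannExp_quadratic_mul_eq_det_mul R hAG, gaussExpect_twoSpeciesCov_psi_mul_psiBar]

end TwoSpecies

/-! ## §5 Dimock–Yuan, App. B LEMMA 23: the characteristic function `∫ e^{−ψ̄Jψ} dμ_G = det(1 + J G)` (finite form) -/

section CharacteristicFunction

variable (R : Type*) [CommRing R] [Algebra ℚ R] {ι : Type*} [LinearOrder ι] [Fintype ι]
variable {A G : Matrix ι ι R} (hAG : A * G = -1)
include hAG

/-- **Dimock–Yuan 2024, App. B LEMMA 23 with the Remark (473), in finite dimensions** (the finite-dimensional case the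
authors generalise, "see [16]" = Feldman–Knörrer–Trubowitz): for the two-species Gaussian Grassmann integral with
(invertible) covariance `G` and EVERY matrix `J`,

  `∫ e^{−⟨ψ̄, Jψ⟩} dμ_G = det(1 + J G)`.

Printed: *"Lemma 23. Let `G`, `h` satisfy the above conditions. An integral `∫[⋯]dμ` on the Grassmann algebra `𝒢_h` is
Gaussian with covariance `G` if and only if the characteristic function satisfies `∫ e^{⟨ψ,Jψ̄⟩}dμ = det(I + JᵀG)` (472)
for all smooth functions `J`. … This can also be written `∫ e^{−⟨ψ̄,Jψ⟩}dμ = det(I + JG)` (473)"*, proved there from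
`∫ ∏ψ(xᵢ)ψ̄(yᵢ) dμ_G = det{G(xᵢ,yⱼ)}` and the Fredholm formula (475).  Here: from §4 with `A = −G⁻¹`,
`(ε det A) · ∫ e^{−ψ̄Jψ}dμ_G = ∫dψ̄dψ e^{ψ̄(A−J)ψ} = ε det(A − J) = ε det A · det(1 + GJ)` and `det(1 + GJ) = det(1 + JG)`;
the "only if" direction in finite form.  Scope: finite index set, `G` invertible (`A G = −1`); the torus ∕ continuum
setting of the paper (trace-class `G = G₁ * G₂`, Fredholm determinant) is NOT formalised.
[cite: DimockYuan2024GNFlow, App. B Lemma 23 (472)–(473) p.70 L68 – p.71 L3; proof (474)–(475) p.71] -/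
theorem gaussExpect_twoSpeciesCov_grassmannExp_neg_quadratic (J : Matrix ι ι R) :
    gaussExpect R (twoSpeciesCov R G) (grassmannExp (-quadratic R J)) = (1 + J * G).det := by
  have hGA : G * A = -1 := mul_eq_neg_one_comm_of_mul_eq_neg_one R hAG
  -- `ε det A` is a unit: `det A · det (−G) = 1`
  have hunit : IsUnit ((-1 : R) ^ (Fintype.card ι * (Fintype.card ι - 1) / 2) * A.det) := by
    refine ((isUnit_one (M := R)).neg.pow _).mul (isUnit_iff_exists_inv.mpr ⟨(-G).det, ?_⟩)
    rw [← Matrix.det_mul, Matrix.mul_neg, hAG, neg_neg, Matrix.det_one]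
  rw [← quadratic_neg]
  have h := berezin_grassmannExp_quadratic_mul_eq_det_mul R hAG (grassmannExp (quadratic R (-J)))
  rw [← grassmannExp_quadratic_add, berezin_grassmannExp_quadratic_holds R (A + -J)] at h
  -- `det (A − J) = det A · det (1 + G J)`
  have hfac : A + -J = A * (1 + G * J) := by
    rw [Matrix.mul_add, Matrix.mul_one, ← Matrix.mul_assoc, hAG, Matrix.neg_mul, Matrix.one_mul]
  rw [hfac, Matrix.det_mul, ← mul_assoc, Matrix.det_one_add_mul_comm] at h
  exact (hunit.mul_right_inj.mp h).symm

/-- **(472), the transposed form**: `∫ e^{⟨ψ, Jψ̄⟩} dμ_G = det(1 + JᵀG)` — `⟨ψ,Jψ̄⟩ = Σ ψᵢJᵢⱼψ̄ⱼ = −Σ ψ̄ⱼJᵢⱼψᵢ = −⟨ψ̄,Jᵀψ⟩`.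
[cite: DimockYuan2024GNFlow, App. B Lemma 23 (472) p.70 L68–73] -/
theorem gaussExpect_twoSpeciesCov_grassmannExp_sum_psi_psiBar (J : Matrix ι ι R) :
    gaussExpect R (twoSpeciesCov R G) (grassmannExp (∑ i, ∑ j, J i j • (psi R i * psiBar R j))) =
      (1 + J.transpose * G).det := by
  have hq : ∑ i, ∑ j, J i j • (psi R i * psiBar R j) = -quadratic R J.transpose := by
    rw [quadratic, Finset.sum_comm, ← Finset.sum_neg_distrib]
    refine Finset.sum_congr rfl fun i _ => ?_
    rw [← Finset.sum_neg_distrib]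
    refine Finset.sum_congr rfl fun j _ => ?_
    rw [Matrix.transpose_apply, psi_mul_psiBar, smul_neg]
  rw [hq, gaussExpect_twoSpeciesCov_grassmannExp_neg_quadratic R hAG]

/-- **The normalisation of a quadratic insertion** (the Laplacian-form constant left symbolic as `∫ dμ_C e^{q}` in
`GrassmannGaussianQuadraticInsertion` ∕ `…Normalisation`, evaluated in the two-species case):
`∫ e^{ψ̄Jψ} dμ_G = det(1 − J G)`. [cite: DimockYuan2024GNFlow, App. B Lemma 23 (473) p.71 L1–3] -/
theorem gaussExpect_twoSpeciesCov_grassmannExp_quadratic (J : Matrix ι ι R) :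
    gaussExpect R (twoSpeciesCov R G) (grassmannExp (quadratic R J)) = (1 - J * G).det := by
  rw [← neg_neg (quadratic R J), ← quadratic_neg, gaussExpect_twoSpeciesCov_grassmannExp_neg_quadratic R hAG,
    Matrix.neg_mul, ← sub_eq_add_neg]

/-- **Dimock–Yuan 2024, App. B LEMMA 24 part 2, (479)–(480), in finite form — a quadratic perturbation of the weight is a
change of covariance**: for `A G = −1`, `(A − J) G′ = −1` (i.e. `G′ = (G⁻¹ + J)⁻¹ = G(1 + JG)⁻¹`, the printed
`G^z_k = G_k(I + z_k∂̸G_k)⁻¹` with `J = z_k∂̸`) and every `F`,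

  `∫ F e^{−⟨ψ̄,Jψ⟩} dμ_G = det(1 + JG) · ∫ F dμ_{G′}`,   `det(1 + JG) = ∫ e^{−⟨ψ̄,Jψ⟩} dμ_G`,

printed as *"`∫[⋯]e^{−z_k∫ψ̄∂̸ψ}dμ_{G_k}(ψ) ∕ ∫e^{−z_k∫ψ̄∂̸ψ}dμ_{G_k}(ψ) = ∫[⋯]dμ_{G^z_k}(ψ)` (479) where
`G^z_k(x,y) = Σ′_p e^{ip(x−y)} (−ip̸∕p²)(1∕(z_k + e^{p²}))` (480)"* and proved there by comparing characteristic functions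
(485)–(487).  Here: both sides are `(ε det A)⁻¹ ∫dψ̄dψ e^{ψ̄(A−J)ψ} F` by §4.  Scope as in
`gaussExpect_twoSpeciesCov_grassmannExp_neg_quadratic` (finite index set, `G` and `G′` invertible).
[cite: DimockYuan2024GNFlow, App. B Lemma 24 (479)–(480) p.72 L1–9; proof (485)–(487) p.72 L60 – p.73 L5] -/
theorem gaussExpect_twoSpeciesCov_grassmannExp_neg_quadratic_mul {G' : Matrix ι ι R} (J : Matrix ι ι R)
    (hG' : (A - J) * G' = -1) (F : GrassmannAlgebra R (ι ⊕ₗ ι)) :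
    gaussExpect R (twoSpeciesCov R G) (grassmannExp (-quadratic R J) * F) =
      (1 + J * G).det * gaussExpect R (twoSpeciesCov R G') F := by
  have hunit : IsUnit ((-1 : R) ^ (Fintype.card ι * (Fintype.card ι - 1) / 2) * A.det) := by
    refine ((isUnit_one (M := R)).neg.pow _).mul (isUnit_iff_exists_inv.mpr ⟨(-G).det, ?_⟩)
    rw [← Matrix.det_mul, Matrix.mul_neg, hAG, neg_neg, Matrix.det_one]
  rw [← quadratic_neg]
  have h1 := berezin_grassmannExp_quadratic_mul_eq_det_mul R hAG (grassmannExp (quadratic R (-J)) * F)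
  have h2 := berezin_grassmannExp_quadratic_mul_eq_det_mul R hG' F
  rw [← mul_assoc, ← grassmannExp_quadratic_add, ← sub_eq_add_neg, h2] at h1
  have hfac : A - J = A * (1 + G * J) := by
    rw [Matrix.mul_add, Matrix.mul_one, ← Matrix.mul_assoc, hAG, Matrix.neg_mul, Matrix.one_mul, sub_eq_add_neg]
  rw [hfac, Matrix.det_mul, Matrix.det_one_add_mul_comm] at h1
  have key : (-1 : R) ^ (Fintype.card ι * (Fintype.card ι - 1) / 2) * A.det *
      ((1 + J * G).det * gaussExpect R (twoSpeciesCov R G') F) =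
      (-1 : R) ^ (Fintype.card ι * (Fintype.card ι - 1) / 2) * A.det *
        gaussExpect R (twoSpeciesCov R G) (grassmannExp (quadratic R (-J)) * F) := by
    simpa only [mul_assoc] using h1
  exact (hunit.mul_right_inj.mp key).symm

omit [Algebra ℚ R] in
/-- The perturbed covariance: `(A − J) G′ = −1` and `A G = −1` give `G′ (1 + JG) = G`, i.e. `G′ = G(1 + JG)⁻¹` — the
printed *"`(G^z_k)⁻¹ = G_k⁻¹ + z_k∂̸ = (I + z_k∂̸G_k)G_k⁻¹` implies `G^z_k = G_k(I + z_k∂̸G_k)⁻¹`"*.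
[cite: DimockYuan2024GNFlow, App. B Lemma 24 proof p.73 L3–5] -/
theorem perturbedCov_mul_one_add_mul {G' : Matrix ι ι R} (J : Matrix ι ι R) (hG' : (A - J) * G' = -1) :
    G' * (1 + J * G) = G := by
  have hG'A : G' * (A - J) = -1 := mul_eq_neg_one_comm_of_mul_eq_neg_one R hG'
  have h : (A - J) * G = -(1 + J * G) := by
    rw [Matrix.sub_mul, hAG, neg_add, sub_eq_add_neg]
  have h2 : G' * ((A - J) * G) = -(G' * (1 + J * G)) := by rw [h, Matrix.mul_neg]
  rw [← Matrix.mul_assoc, hG'A, Matrix.neg_mul, Matrix.one_mul, neg_inj] at h2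
  exact h2.symm

/-- **Dimock 2025 (D11), §2.2 PROPOSITION 3 (57), in finite form — the tilted Gaussian is Gaussian with covariance
`G(1 − KG)⁻¹`**: for `A G = −1`, `(A + K) G′ = −1` and every `F`,
`∫ F e^{⟨ψ̄,Kψ⟩} dμ_G = det(1 − KG) · ∫ F dμ_{G′}` with `G′(1 − KG) = G` (`tiltedCov_mul_one_sub_mul`).  Printed:
*"Proposition 3. Let `K(x,y)` be a smooth function on `𝕋 × 𝕋` and `K` the associated bounded operator on `L²(𝕋)`. Suppose
`‖KG‖ < 1` so `(I − KG)⁻¹` exists. Then `∫ F dμ_{G,K}(ψ) ≡ ∫ F e^{⟨ψ̄,Kψ⟩}dμ_G(ψ) ∕ ∫ e^{⟨ψ̄,Kψ⟩}dμ_G(ψ)` (57) is the Gaussian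
integral on `𝒢_h` with covariance `G(I − KG)⁻¹`. Proof. The denominator is `det(I − KG)` …"* — here the finite index set,
`G` and `G′` invertible, the denominator `det(1 − KG)` kept as a factor (no division).
[cite: Dimock2025GNCorrelations, §2.2 Proposition 3 (57) p.11 L23–31; proof p.11 L31–45] -/
theorem gaussExpect_twoSpeciesCov_grassmannExp_quadratic_mul {G' : Matrix ι ι R} (K : Matrix ι ι R)
    (hG' : (A + K) * G' = -1) (F : GrassmannAlgebra R (ι ⊕ₗ ι)) :
    gaussExpect R (twoSpeciesCov R G) (grassmannExp (quadratic R K) * F) =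
      (1 - K * G).det * gaussExpect R (twoSpeciesCov R G') F := by
  have hG'' : (A - -K) * G' = -1 := by rwa [sub_neg_eq_add]
  have h := gaussExpect_twoSpeciesCov_grassmannExp_neg_quadratic_mul R hAG (-K) hG'' F
  rwa [quadratic_neg, neg_neg, Matrix.neg_mul, ← sub_eq_add_neg] at h

omit [Algebra ℚ R] in
/-- The tilted covariance: `(A + K) G′ = −1` and `A G = −1` give `G′ (1 − KG) = G`, i.e. `G′ = G(1 − KG)⁻¹` (`G` and
`1 − KG` commute with this inverse: `G(1−KG)⁻¹ = (1−GK)⁻¹G = (G⁻¹ − K)⁻¹`). [cite: Dimock2025GNCorrelations, §2.2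
Proposition 3 (57) p.11 L23–31] -/
theorem tiltedCov_mul_one_sub_mul {G' : Matrix ι ι R} (K : Matrix ι ι R) (hG' : (A + K) * G' = -1) :
    G' * (1 - K * G) = G := by
  have hG'' : (A - -K) * G' = -1 := by rwa [sub_neg_eq_add]
  have h := perturbedCov_mul_one_add_mul R hAG (-K) hG''
  rwa [Matrix.neg_mul, ← sub_eq_add_neg] at h

end CharacteristicFunction

/-! ## §6 One species: the Pfaffian normalisation of a quadratic insertion -/

section Pfaffian

open Literature.LinearAlgebra.Matrix (pfaffian)

variable {R : Type*} [CommRing R] [Algebra ℚ R] {n : ℕ}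
variable (N : Matrix (Fin n) (Fin n) R) {M : Matrix (Fin n) (Fin n) R}
  (hM : M * (Matrix.of fun X Y => N X Y - N Y X) = 1) (hMt : M.transpose = -M)
include hM hMt

/-- **The value of a quadratic insertion in one species is a ratio of Pfaffians**: for `q = Σ N θθ` on `Fin n` with
`S = N − Nᵀ` invertible, `M S = 1`, `Mᵀ = −M` (so `dμ_M` is the Gaussian of §3 attached to the weight `e^{q}`), and every
`J`,

  `Pf(N − Nᵀ) · ∫ e^{Σ Jᵢⱼ θᵢθⱼ} dμ_M = Pf((N + J) − (N + J)ᵀ)`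

— §3 applied to `F = e^{ΣJθθ}` and the tree's one-species Gaussian Berezin integral `∫dθ e^{ΣBθθ} = Pf(B − Bᵀ)`
(`berezin_grassmannExp_sum_sum`; Zinn-Justin 2021 (1.73)–(1.77), Wegner 2016 (5.4)).  This evaluates, in one species, the
constant `∫ dμ_C e^{q}` that `GrassmannGaussianQuadraticInsertion` leaves symbolic. [cite: ZinnJustin2021, §1.9 (1.73)–(1.77)] -/
theorem pfaffian_mul_gaussExpect_grassmannExp_sum_sum (J : Matrix (Fin n) (Fin n) R) :
    pfaffian (N - N.transpose) * gaussExpect R M (grassmannExp (∑ i, ∑ j, J i j • (gen R i * gen R j))) =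
      pfaffian ((N + J) - (N + J).transpose) := by
  set q : GrassmannAlgebra R (Fin n) := ∑ i, ∑ j, N i j • (gen R i * gen R j) with hq
  set qJ : GrassmannAlgebra R (Fin n) := ∑ i, ∑ j, J i j • (gen R i * gen R j) with hqJ
  have h := berezin_grassmannExp_mul_of_transpose N hq rfl hM hMt (grassmannExp qJ)
  rw [berezin_grassmannExp_sum_sum] at h
  have hsum : q + qJ = ∑ i, ∑ j, (N + J) i j • (gen R i * gen R j) := by
    simp only [hq, hqJ, Matrix.add_apply, add_smul, Finset.sum_add_distrib]
  have hprod : grassmannExp q * grassmannExp qJ = grassmannExp (q + qJ) := by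
    rw [grassmannExp, grassmannExp, grassmannExp, ← IsNilpotent.exp_add_of_commute (commute_of_eq_quadratic N hq qJ)
      (isNilpotent_of_eq_quadratic N hq) (isNilpotent_of_eq_quadratic J hqJ)]
  rw [hprod, hsum, berezin_grassmannExp_sum_sum] at h
  exact h.symm

end Pfaffian

/-! ## §7 The third layer: the block integration `gaussOn` of `GrassmannGaussianExpectation` -/

section GaussOn

variable (R : Type*) [CommRing R] [Algebra ℚ R] {ι : Type*} [LinearOrder ι] [Fintype ι]
  {J : Type*} [LinearOrder J] [Fintype J] (e : ι ⊕ₗ ι ↪o J) {A G : Matrix ι ι R} (hAG : A * G = -1)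
include hAG

/-- **The block Gaussian integration `gaussOn` on functions of the block is the charged Gaussian expectation**: for
`y` in the fermion algebra of the block placed by `e : ι ⊕ₗ ι ↪o J` and `A G = −1`,
`gaussOn R e A (e_* y) = ((−1)^{n(n−1)∕2} det A · ∫ y dμ_G) · 1` — the un-normalised Berezin-form block integration of
Benfatto–Giuliani–Mastropietro 2006 (2.2) ∕ Mastropietro 2008 (2.20)–(2.23) (`gaussOn_map`: `= (∫dψ̄dψ e^{ψ̄Aψ} y)·1`)
identified with the Laplacian form through §4. [cite: Mastropietro2008, Ch. 2 (2.20)–(2.24)] -/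
theorem gaussOn_map_eq_det_mul_gaussExpect (y : GrassmannAlgebra R (ι ⊕ₗ ι)) :
    gaussOn R e A (ExteriorAlgebra.map (Function.ExtendByZero.linearMap R e) y) =
      algebraMap R _ ((-1 : R) ^ (Fintype.card ι * (Fintype.card ι - 1) / 2) * A.det *
        gaussExpect R (twoSpeciesCov R G) y) := by
  rw [gaussOn_map, berezin_grassmannExp_quadratic_mul_eq_det_mul R hAG]

/-- **Normalised form**: `gaussOn R e A (e_* y) = (∫ y dμ_G) • gaussOn R e A 1` — the BGM ∕ Mastropietro expectation
`𝓔(F) = 𝒩⁻¹∫P(dψ)F` of a function of the block is the Laplacian-form Gaussian expectation with covariance `G = −A⁻¹`.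
[cite: Mastropietro2008, Ch. 2 (2.20)–(2.24)] -/
theorem gaussOn_map_eq_gaussExpect_smul_gaussOn_one (y : GrassmannAlgebra R (ι ⊕ₗ ι)) :
    gaussOn R e A (ExteriorAlgebra.map (Function.ExtendByZero.linearMap R e) y) =
      gaussExpect R (twoSpeciesCov R G) y • gaussOn R e A 1 := by
  rw [gaussOn_map_eq_det_mul_gaussExpect R e hAG, gaussOn_one, Algebra.algebraMap_eq_smul_one,
    Algebra.algebraMap_eq_smul_one, smul_smul, mul_comm]

/-- **Dimock 2025 (D11), §2.3 PROPOSITION 5 (67) — the generating function `∫ e^{⟨J̄,ψ⟩+⟨ψ̄,J⟩} dμ_G = e^{⟨J̄,GJ⟩}`, in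
finite form with Grassmann sources** (Berezin form with spectators): for degree-one sources `J̄ᵢ = ι(v̄ᵢ)`, `Jᵢ = ι(vᵢ)`
supported outside the block and `A G = −1`,
`gaussOn R e A (e^{Σᵢ(J̄ᵢψᵢ + ψ̄ᵢJᵢ)}) = ((−1)^{n(n−1)∕2} det A) • e^{Σᵢⱼ Gᵢⱼ J̄ᵢJⱼ}` — the tree's `gaussOn_grassmannExp_sources`
(Salmhofer 1999 App. B Lemma B.6; there with `−A⁻¹` in the exponent) read with Dimock's covariance `G = −A⁻¹`.  Printed:
*"Proposition 5. `∫ e^{⟨J̄,ψ⟩+⟨ψ̄,J⟩} dμ_G(ψ) = e^{⟨J̄,GJ⟩}` (67)"* (the normalised integral; here un-normalised, the factor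
`gaussOn R e A 1 = ε det A` of `gaussOn_one` explicit). [cite: Dimock2025GNCorrelations, §2.3 Proposition 5 (67) p.13
L42–43; proof (68)–(69) p.13] -/
theorem gaussOn_grassmannExp_sources_eq_det_smul (vbar v : ι → J → R) (hvbar : ∀ i k, vbar i (e k) = 0)
    (hv : ∀ i k, v i (e k) = 0) :
    gaussOn R e A (grassmannExp (∑ i, (ExteriorAlgebra.ι R (vbar i) * gen R (e (toLex (Sum.inr i))) +
        gen R (e (toLex (Sum.inl i))) * ExteriorAlgebra.ι R (v i)))) =
      ((-1 : R) ^ (Fintype.card ι * (Fintype.card ι - 1) / 2) * A.det) •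
        grassmannExp (∑ i, ∑ j, G i j • (ExteriorAlgebra.ι R (vbar i) * ExteriorAlgebra.ι R (v j))) := by
  have hAG' : A * (-G) = 1 := by rw [Matrix.mul_neg, hAG, neg_neg]
  have hA : IsUnit A.det := Matrix.isUnit_det_of_right_inverse hAG'
  have hinv : A⁻¹ = -G := Matrix.inv_eq_right_inv hAG'
  rw [gaussOn_grassmannExp_sources R e A hA vbar v hvbar hv, hinv]
  congr 2
  simp only [Matrix.neg_apply, neg_smul, Finset.sum_neg_distrib, neg_neg]

end GaussOn

end Literature.MathematicalPhysics.QuantumLattice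

end
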